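import Mathlib
import Summits.ResolutionOfSingularities.ResolutionOfSingularities.Theorems.HomologicalConductorPersistenceCyclicQuotientNumeration
import HarnessLib

/-!
# Rung S-2 `PersistenceSurface` (stmt-ResolutionOfSingularities-19970), stub C1 (`Sat₄`) on the toric class —
# toward S4 (drops = greedy digits): the `j`-series, the determinant identity, and `q · j_s ≡ i_s (mod n)`

Route `ResolutionOfSingularities/HomologicalConductor`, rung S-2 `PersistenceSurface` (stmt-19970), registered stub
`stub_saturationFourSurfaceResidualFour`, class (iii).  [OURS · cell decomp-res · seat leafhand-res-homologicalconduct-13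
gen 0; AI-written, weaker than expert review; NOT a statement of the manuscript under review (Hironaka 2017).]

First bricks of the SHORT ROUTE to S4 recorded in hand census HAND13-NUMERATION §2 (the identification of the drops of
a record staircase `c_s = (α − q j) mod n` with the greedy digits along the `i`-series, via «the successive minima
of `q·d mod n` are the `i`-series»).  For a Hirzebruch–Jung chain `(e, i, b)` (parts 1–3, `…Numeration{Chain,Runs,}`):
* `exists_jSeries` — the `j`-SERIES as data: `j 0 = 0`, `j 1 = 1`, `j (s-1) + j (s+1) = b s · j s` (`1 ≤ s ≤ e`),
  non-decreasing (def-free existence, by the recursion `j (s+1) = b s j s − j (s-1)`);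
* `det_identity` — `i (s-1) · j s = i s · j (s-1) + i 0` for `1 ≤ s ≤ e + 1` (LEMMA D: the consecutive pairs
  `(j_{s-1}, i_{s-1}), (j_s, i_s)` span a lattice of index `n = i 0`);
* `exists_kSeries` — LEMMA F1 in certificate form: for `1 ≤ s ≤ e + 1` there is `k` with `i s + i 0 · k = i 1 · j s`,
  i.e. `q · j_s ≡ i_s (mod n)`; in particular `j (e+1) · q ≡ 0`, and `mod_eq_of_kSeries`: `(i 1 * j s) % i 0 = i s`
  for `1 ≤ s ≤ e` (`i s < i 0`).
What is NOT here: LEMMA F2 (for `1 ≤ d < j s`, `(q d) % n ≥ i (s-1)` — the lattice sign chase), LEMMA G (greedy drop)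
and the assembly; see HAND13-NUMERATION §2 for statements, proofs on paper and sizes.  No crux, kill test or summit
statement is proved here.

References: O. Riemenschneider, Math. Ann. 209 (1974) (`i`/`j`-series of `1/n(1,q)`; language only); HAND13-NUMERATION
§2 (OURS, cell memo).
-/

-- single-problem summit: the doubled namespace component `ResolutionOfSingularities` is forced
set_option linter.dupNamespace false

namespace Summit.ResolutionOfSingularities.ResolutionOfSingularities.Theorems.HomologicalConductor.PersistenceCyclicQuotientNumeration

/-- **The `j`-series exists** (def-free): `j 0 = 0`, `j 1 = 1`, `j (s-1) + j (s+1) = b s · j s` for `1 ≤ s ≤ e`,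
and `j` is non-decreasing on `[0, e+1]` (indeed increasing, as `b ≥ 2`). [folklore] -/
theorem exists_jSeries {e : ℕ} {b : ℕ → ℕ} (hb : ∀ s, 1 ≤ s → s ≤ e → 2 ≤ b s) :
    ∃ j : ℕ → ℕ, j 0 = 0 ∧ j 1 = 1 ∧ (∀ s, 1 ≤ s → s ≤ e → j (s - 1) + j (s + 1) = b s * j s) ∧
      (∀ s, s ≤ e → j s ≤ j (s + 1)) := by
  -- pairs `(j s, j (s+1))`
  let J : ℕ → ℕ × ℕ := fun s => Nat.rec ((0, 1) : ℕ × ℕ) (fun s p => (p.2, b (s + 1) * p.2 - p.1)) s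
  have hJ0 : J 0 = (0, 1) := rfl
  have hJs : ∀ s, J (s + 1) = ((J s).2, b (s + 1) * (J s).2 - (J s).1) := fun s => rfl
  have hfst : ∀ s, (J (s + 1)).1 = (J s).2 := fun s => by rw [hJs]
  have hsnd : ∀ s, (J (s + 1)).2 = b (s + 1) * (J s).2 - (J s).1 := fun s => by rw [hJs]
  -- monotonicity `(J r).1 ≤ (J r).2` on `[0, e]`
  have hmono : ∀ r, r ≤ e → (J r).1 ≤ (J r).2 := by
    intro r hr
    induction r with
    | zero => rw [hJ0]; exact Nat.zero_le _
    | succ r ih =>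
      rw [hfst, hsnd]
      have h1 := ih (by omega)
      have h2 : 2 * (J r).2 ≤ b (r + 1) * (J r).2 := Nat.mul_le_mul_right _ (hb (r + 1) (by omega) (by omega))
      omega
  refine ⟨fun s => (J s).1, rfl, rfl, ?_, ?_⟩
  · intro s hs1 hse
    show (J (s - 1)).1 + (J (s + 1)).1 = b s * (J s).1
    obtain ⟨t, rfl⟩ : ∃ t, s = t + 1 := ⟨s - 1, by omega⟩
    rw [Nat.add_sub_cancel, hfst (t + 1), hsnd t, hfst t]
    have h1 := hmono t (by omega)
    have h2 : 2 * (J t).2 ≤ b (t + 1) * (J t).2 := Nat.mul_le_mul_right _ (hb (t + 1) (by omega) hse)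
    omega
  · intro s hse
    show (J s).1 ≤ (J (s + 1)).1
    rw [hfst]
    exact hmono s hse

/-- **LEMMA D (determinant identity).**  Along the chain, `i (s-1) · j s = i s · j (s-1) + i 0` for `1 ≤ s ≤ e + 1`:
the lattice `{(x, y) : y ≡ q x (mod n)}` has the consecutive pairs `(j_{s-1}, i_{s-1}), (j_s, i_s)` as a basis.
[folklore] -/
theorem det_identity {e : ℕ} {i b j : ℕ → ℕ}
    (hrec : ∀ s, 1 ≤ s → s ≤ e → i (s - 1) + i (s + 1) = b s * i s)
    (hj0 : j 0 = 0) (hj1 : j 1 = 1) (hjrec : ∀ s, 1 ≤ s → s ≤ e → j (s - 1) + j (s + 1) = b s * j s) :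
    ∀ s, 1 ≤ s → s ≤ e + 1 → i (s - 1) * j s = i s * j (s - 1) + i 0 := by
  intro s hs1 hse
  induction s with
  | zero => omega
  | succ s ih =>
    rcases Nat.eq_zero_or_pos s with rfl | hs
    · simp [hj0, hj1]
    · have h := ih hs (by omega)
      have hi := hrec s hs (by omega)
      have hj := hjrec s hs (by omega)
      rw [Nat.add_sub_cancel]
      -- `(i(s-1) + i(s+1)) j s = b s i s j s = i s (j(s-1) + j(s+1))`
      have h1 : (i (s - 1) + i (s + 1)) * j s = i s * (j (s - 1) + j (s + 1)) := by
        rw [hi, hj]; ring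
      have h2 : i (s - 1) * j s + i (s + 1) * j s = i s * j (s - 1) + i s * j (s + 1) := by
        rw [← Nat.add_mul, h1, Nat.mul_add]
      omega

/-- **LEMMA F1 (certificate form): `q · j_s ≡ i_s (mod n)`** — for `1 ≤ s ≤ e + 1` there is `k : ℕ` with
`i s + i 0 · k = i 1 · j s` (the `k`-series `0, 1, b 2 − 0, …`, obeying the same recursion). [folklore] -/
theorem exists_kSeries {e : ℕ} {i b j : ℕ → ℕ}
    (hrec : ∀ s, 1 ≤ s → s ≤ e → i (s - 1) + i (s + 1) = b s * i s) (hb : ∀ s, 1 ≤ s → s ≤ e → 2 ≤ b s)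
    (hj0 : j 0 = 0) (hj1 : j 1 = 1) (hjrec : ∀ s, 1 ≤ s → s ≤ e → j (s - 1) + j (s + 1) = b s * j s) :
    ∀ s, 1 ≤ s → s ≤ e + 1 → ∃ k, i s + i 0 * k = i 1 * j s := by
  -- two consecutive certificates with `k ≤ k'`
  have key : ∀ s, 2 ≤ s → s ≤ e + 1 → ∃ k k', k ≤ k' ∧ i (s - 1) + i 0 * k = i 1 * j (s - 1) ∧
      i s + i 0 * k' = i 1 * j s := by
    intro s hs2 hse
    induction s with
    | zero => omega
    | succ s ih =>
      rcases Nat.lt_or_ge 1 s with hs | hs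
      · obtain ⟨k, k', hkk', hk, hk'⟩ := ih (by omega) (by omega)
        have hi := hrec s (by omega) (by omega)
        have hj := hjrec s (by omega) (by omega)
        have hbs := hb s (by omega) (by omega)
        have h2k : 2 * k' ≤ b s * k' := Nat.mul_le_mul_right _ hbs
        have hkle : k ≤ b s * k' := by omega
        refine ⟨k', b s * k' - k, by omega, by rw [Nat.add_sub_cancel]; exact hk', ?_⟩
        -- `i(s+1) + n (b k' − k) = b (i s + n k') − (i(s-1) + n k) = q (b j s − j(s-1)) = q j(s+1)`
        have E1 : i 0 * (b s * k' - k) + i 0 * k = b s * (i 0 * k') := by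
          rw [← Nat.mul_add, Nat.sub_add_cancel hkle]; ring
        have E2 : b s * i s + b s * (i 0 * k') = b s * (i 1 * j s) := by rw [← Nat.mul_add, hk']
        have E3 : b s * (i 1 * j s) = i 1 * j (s - 1) + i 1 * j (s + 1) := by
          rw [show b s * (i 1 * j s) = i 1 * (b s * j s) by ring, ← hj, Nat.mul_add]
        omega
      · -- `s + 1 = 2`
        obtain rfl : s = 1 := by omega
        refine ⟨0, 1, Nat.zero_le _, by simp [hj1], ?_⟩
        have hi := hrec 1 le_rfl (by omega)
        have hj := hjrec 1 le_rfl (by omega)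
        rw [Nat.sub_self, hj0, Nat.zero_add, hj1, Nat.mul_one] at hj
        rw [Nat.sub_self] at hi
        show i (1 + 1) + i 0 * 1 = i 1 * j (1 + 1)
        rw [hj, Nat.mul_one, Nat.mul_comm]
        omega
  intro s hs1 hse
  rcases Nat.lt_or_ge 1 s with hs | hs
  · obtain ⟨k, k', -, -, hk'⟩ := key s hs hse
    exact ⟨k', hk'⟩
  · obtain rfl : s = 1 := le_antisymm hs hs1
    exact ⟨0, by simp [hj1]⟩

/-- **`(q · j_s) % n = i_s`** for `1 ≤ s ≤ e` (LEMMA F1 read as a remainder; `i s < i 0 = n`). [folklore] -/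
theorem mod_eq_of_kSeries {e : ℕ} {i b j : ℕ → ℕ} (hie : i e = 1) (hie1 : i (e + 1) = 0)
    (hrec : ∀ s, 1 ≤ s → s ≤ e → i (s - 1) + i (s + 1) = b s * i s) (hb : ∀ s, 1 ≤ s → s ≤ e → 2 ≤ b s)
    (hj0 : j 0 = 0) (hj1 : j 1 = 1) (hjrec : ∀ s, 1 ≤ s → s ≤ e → j (s - 1) + j (s + 1) = b s * j s)
    (s : ℕ) (hs1 : 1 ≤ s) (hse : s ≤ e) : (i 1 * j s) % i 0 = i s := by
  obtain ⟨k, hk⟩ := exists_kSeries hrec hb hj0 hj1 hjrec s hs1 (by omega)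
  have hlt : i s < i 0 := by
    have h2 := two_mul_le_of_chain hrec hb
    have := le_of_chain hie hie1 h2 1 s hs1 (by omega)
    have h0 := lt_of_chain hie hie1 h2 0 (Nat.zero_le _)
    rw [Nat.zero_add] at h0
    omega
  rw [← hk, Nat.add_mul_mod_self_left, Nat.mod_eq_of_lt hlt]

end Summit.ResolutionOfSingularities.ResolutionOfSingularities.Theorems.HomologicalConductor.PersistenceCyclicQuotientNumeration
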